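import Mathlib.NumberTheory.Niven
import Mathlib.RingTheory.RootsOfUnity.Complex
import Mathlib.RingTheory.RootsOfUnity.Lemmas
import Mathlib.RingTheory.RootsOfUnity.Minpoly
import HarnessLib

/-!
# Crux `ROT` (stmt-QuantumFields-20042), stub `stub_kingLimit` — number-theoretic input of the crystallographic exclusion of the finite
# planar stabilisers `C_{4m}`, `m ≥ 2`: `cos (π/(2m))` is NOT an algebraic integer, so the composite rotation has an irrational angle

Helper file (`--supports stmt-QuantumFields-20042 --as helper`; seat `ymfull-r2d-prover-1`, R590-ym item (15)).  Companion of
✓`Theorems/BalabanLadderROTKingLimitStabiliser.lean` (p783639): there the registered stub `KingLimit` was shown EQUIVALENT to «no off-diagonal UV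
limit point has planar stabiliser `(π/(2m))ℤ`, `m ≥ 1`, on King's class» (`ROT.KingStabiliser.kingLimit_iff_noCyclicStabiliser`).  The announced
upgrade (next files) excludes every `m ≥ 2` by pure group theory: the limit points are `W(B₄)`-invariant
(✓`CheckerboardTrialityHyperoctahedral.signedPerm_invariant_of_offDiagLimitAlong`), and the composite of the plane rotation `R₀₁(π/(2m))` with the signed
permutation `e₀ ↔ e₂, e₁ ↦ −e₁` is a rotation of `⟨e₀,e₁,e₂⟩` whose angle `ω` satisfies `2 cos ω = −1 − cos (π/(2m))` (trace identity); such a rotation has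
INFINITE ORDER, i.e. `ω/π ∉ ℚ`, as soon as `cos (π/(2m))` is not an algebraic integer — because `2 cos (rπ)` IS one for rational `r` (Mathlib
`Real.isIntegral_two_mul_cos_rat_mul_pi`).  This file supplies exactly that arithmetic:

* `sixteen_mul_sq_lt_two_pow` — `16 m² < 2^(4m−1)` for `m ≥ 2`.
* ★ `not_isIntegral_cos_pi_div_two_mul` — **`cos (π/(2m))` is not integral over `ℤ` for `m ≥ 2`.**  Uniform cyclotomic proof: with `z = e^{2πi/4m}` (a primitive
  `4m`-th root of unity, an algebraic integer) one has `z + z⁻¹ = 2 cos (π/(2m))`; if `x = cos (π/(2m))` were integral then `(1 − z)² = 2·z(x − 1) ∈ 2ℤ̄`, and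
  squaring `∏_{k=1}^{4m−1} (1 − z^k) = 4m` (Mathlib `IsPrimitiveRoot.prod_one_sub_pow_eq_order`) with `1 − z^k = (1 − z)(1 + z + ⋯ + z^{k−1})` gives
  `(4m)² ∈ 2^{4m−1} ℤ̄`; a rational algebraic integer is an integer, and `0 < 16m²/2^{4m−1} < 1` — contradiction.
* `irrational_div_pi_of_cos_eq` — if `cos (π/(2m)) = ε·(2 cos ω) + k` with `ε, k ∈ ℤ` and `m ≥ 2`, then `ω/π` is irrational; in particular
  (`irrational_div_pi_of_two_cos_eq_neg`) for the composite rotation above, `2 cos ω = −1 − cos (π/(2m)) ⇒ ω/π ∉ ℚ`.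

Pure arithmetic (no Yang–Mills object occurs); 0 sorry, standard axioms, no definition.  HONEST LABEL: an input lemma of a structural reduction of
`stub_kingLimit`; `KingLimit`, `ROT` and the Yang–Mills mass gap are NOT proved.

References: I. Niven, Irrational Numbers (1956) Ch. III §3; Washington, Introduction to Cyclotomic Fields (1997) Prop. 2.8 / Lemma 1.4 (the product
`∏ (1 − ζ^k) = n`); Mathlib `Mathlib.NumberTheory.Niven`.
-/

set_option autoImplicit false

noncomputable section

open scoped BigOperators

namespace Summit.QuantumFields.YangMills.Theorems.ROT.KingStabiliser

/-- `16 m² < 2^(4m−1)` for `m ≥ 2`. [folklore] -/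
theorem sixteen_mul_sq_lt_two_pow {m : ℕ} (hm : 2 ≤ m) : 16 * m ^ 2 < 2 ^ (4 * m - 1) := by
  induction m, hm using Nat.le_induction with
  | base => norm_num
  | succ m hm ih =>
    have hpow : 2 ^ (4 * (m + 1) - 1) = 2 ^ (4 * m - 1) * 16 := by
      rw [show 4 * (m + 1) - 1 = 4 * m - 1 + 4 by omega, pow_add]
      norm_num
    rw [hpow]
    nlinarith [ih, hm]

/-- ★ **`cos (π/(2m))` is not an algebraic integer for `m ≥ 2`.**  (For `m = 1` it is `0`.)  Cyclotomic proof through the primitive `4m`-th root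
of unity `z = e^{2πi/(4m)}`: `z + z⁻¹ = 2 cos (π/(2m))`, so integrality of the cosine forces `(1 − z)² = 2 z (cos (π/(2m)) − 1) ∈ 2ℤ̄`, whence
`(4m)² = ((1 − z)²)^{4m−1} · (∏_{k<4m−1} (1 + z + ⋯ + z^k))² ∈ 2^{4m−1} ℤ̄` by `∏_{k=1}^{4m−1} (1 − z^k) = 4m`; but `16m²/2^{4m−1} ∈ (0,1)` is not an
integer. [cite: Niven1956, Ch. III §3] -/
theorem not_isIntegral_cos_pi_div_two_mul {m : ℕ} (hm : 2 ≤ m) :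
    ¬ IsIntegral ℤ (Real.cos (Real.pi / (2 * m))) := by
  intro hx
  have hm0 : (m : ℝ) ≠ 0 := by exact_mod_cast (show m ≠ 0 by omega)
  set N : ℕ := 4 * m with hN
  have hN0 : N ≠ 0 := by omega
  have hN1 : N - 1 + 1 = N := Nat.sub_add_cancel (by omega)
  -- the primitive `N`-th root of unity `z = e^{2πi/N}` and the cosine `x`, both in `ℂ`
  set z : ℂ := Complex.exp (2 * Real.pi * Complex.I / N) with hz
  have hprim : IsPrimitiveRoot z N := Complex.isPrimitiveRoot_exp N hN0
  have hzint : IsIntegral ℤ z := hprim.isIntegral (Nat.pos_of_ne_zero hN0)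
  have hz0 : z ≠ 0 := Complex.exp_ne_zero _
  set x : ℂ := ((Real.cos (Real.pi / (2 * m)) : ℝ) : ℂ) with hxdef
  have hxint : IsIntegral ℤ x := by
    have h := (isIntegral_algebraMap_iff (R := ℤ) (A := ℝ) (B := ℂ) RCLike.ofReal_injective).mpr hx
    rw [Complex.coe_algebraMap] at h
    rw [hxdef]
    exact h
  -- `z + z⁻¹ = 2x`
  have hzθ : z = Complex.exp (((Real.pi / (2 * m) : ℝ) : ℂ) * Complex.I) := by
    rw [hz]
    congr 1
    rw [hN]
    push_cast
    field_simp
    ring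
  have hzx : z + z⁻¹ = 2 * x := by
    rw [hzθ, ← Complex.exp_neg, ← neg_mul, Complex.exp_mul_I, Complex.exp_mul_I, hxdef, Complex.ofReal_cos]
    simp only [Complex.cos_neg, Complex.sin_neg]
    ring
  -- `(1 - z)² = 2 w` with `w = z (x - 1)` integral
  have hsq : (1 - z) ^ 2 = 2 * (z * (x - 1)) := by
    have h1 : z ^ 2 + 1 = z * (2 * x) := by
      rw [← hzx, mul_add, mul_inv_cancel₀ hz0]
      ring
    linear_combination h1
  set w : ℂ := z * (x - 1) with hw
  have hwint : IsIntegral ℤ w := hzint.mul (hxint.sub isIntegral_one)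
  -- `∏_{k < N-1} (1 - z^(k+1)) = N`
  have hprod : ∏ k ∈ Finset.range (N - 1), (1 - z ^ (k + 1)) = (N : ℂ) := by
    have hp : IsPrimitiveRoot z (N - 1 + 1) := by rw [hN1]; exact hprim
    rw [hp.prod_one_sub_pow_eq_order]
    exact_mod_cast congrArg (Nat.cast (R := ℂ)) hN1
  -- `1 - z^(k+1) = (1 - z) g_k` with `g_k = 1 + z + ⋯ + z^k` integral
  have hgeom : ∀ k : ℕ, 1 - z ^ (k + 1) = (1 - z) * ∑ i ∈ Finset.range (k + 1), z ^ i := fun k =>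
    (mul_neg_geom_sum z (k + 1)).symm
  set G : ℂ := ∏ k ∈ Finset.range (N - 1), ∑ i ∈ Finset.range (k + 1), z ^ i with hG
  have hGint : IsIntegral ℤ G := IsIntegral.prod _ fun k _ => IsIntegral.sum _ fun i _ => hzint.pow i
  have hNfac : (N : ℂ) = (1 - z) ^ (N - 1) * G := by
    rw [← hprod, Finset.prod_congr rfl fun k _ => hgeom k, Finset.prod_mul_distrib, Finset.prod_const, Finset.card_range]
  -- square: `N² = 2^(N-1) y` with `y = w^(N-1) G²` integral
  set y : ℂ := w ^ (N - 1) * G ^ 2 with hy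
  have hyint : IsIntegral ℤ y := (hwint.pow _).mul (hGint.pow 2)
  have hN2 : ((N : ℂ)) ^ 2 = 2 ^ (N - 1) * y := by
    rw [hNfac, mul_pow, ← pow_mul, mul_comm (N - 1) 2, pow_mul, hsq, mul_pow, hy]
    ring
  -- `y` is the rational number `N² / 2^(N-1)`
  have hyq : y = (((N : ℚ) ^ 2 / 2 ^ (N - 1) : ℚ) : ℂ) := by
    have h2 : (2 : ℂ) ^ (N - 1) ≠ 0 := pow_ne_zero _ two_ne_zero
    push_cast
    rw [eq_div_iff h2, mul_comm, ← hN2]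
  -- a rational algebraic integer is an integer
  obtain ⟨k, hk⟩ := hyint.exists_int_iff_exists_rat.1 ⟨_, hyq⟩
  have hq : (N : ℚ) ^ 2 / 2 ^ (N - 1) = (k : ℚ) := by
    have h := hyq.symm.trans hk
    exact_mod_cast h
  -- but `0 < N² / 2^(N-1) < 1`
  have hkpos : (0 : ℚ) < k := by
    rw [← hq]
    have : (0 : ℚ) < N := by exact_mod_cast Nat.pos_of_ne_zero hN0
    positivity
  have hklt : (k : ℚ) < 1 := by
    rw [← hq, div_lt_one (by positivity)]
    have h := sixteen_mul_sq_lt_two_pow hm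
    have h' : ((16 * m ^ 2 : ℕ) : ℚ) < ((2 ^ (4 * m - 1) : ℕ) : ℚ) := by exact_mod_cast h
    have hNq : (N : ℚ) ^ 2 = ((16 * m ^ 2 : ℕ) : ℚ) := by
      rw [hN]
      push_cast
      ring
    rw [hNq, hN]
    push_cast at h' ⊢
    exact h'
  have hk1 : (0 : ℤ) < k := by exact_mod_cast hkpos
  have hk2 : k < (1 : ℤ) := by exact_mod_cast hklt
  omega

/-- **A relation `cos (π/(2m)) = ε·(2 cos ω) + k` (`ε, k ∈ ℤ`, `m ≥ 2`) forces `ω/π ∉ ℚ`**: otherwise `2 cos ω = 2 cos (rπ)` is an algebraic integer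
(Mathlib `Real.isIntegral_two_mul_cos_rat_mul_pi`) and so would be `cos (π/(2m))`. [cite: Niven1956, Ch. III §3] -/
theorem irrational_div_pi_of_cos_eq {m : ℕ} (hm : 2 ≤ m) {ω : ℝ} (ε k : ℤ)
    (h : Real.cos (Real.pi / (2 * m)) = ε * (2 * Real.cos ω) + k) : Irrational (ω / Real.pi) := by
  rintro ⟨r, hr⟩
  have hω : ω = r * Real.pi := by
    rw [eq_div_iff Real.pi_ne_zero] at hr
    exact hr.symm
  have hint : IsIntegral ℤ (2 * Real.cos ω) := by
    rw [hω]
    exact Real.isIntegral_two_mul_cos_rat_mul_pi r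
  have hε : IsIntegral ℤ (ε : ℝ) := by simpa using isIntegral_algebraMap (R := ℤ) (A := ℝ) (x := ε)
  have hk : IsIntegral ℤ (k : ℝ) := by simpa using isIntegral_algebraMap (R := ℤ) (A := ℝ) (x := k)
  refine not_isIntegral_cos_pi_div_two_mul hm ?_
  rw [h]
  exact (hε.mul hint).add hk

/-- ★ **The composite rotation has an irrational angle**: if `2 cos ω = −1 − cos (π/(2m))` with `m ≥ 2` (the trace identity of
`R₀₁(π/(2m)) ∘ σ` for the signed permutation `σ : e₀ ↔ e₂, e₁ ↦ −e₁`), then `ω/π` is irrational — the rotation has infinite order.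
[cite: Niven1956, Ch. III §3] -/
theorem irrational_div_pi_of_two_cos_eq_neg {m : ℕ} (hm : 2 ≤ m) {ω : ℝ}
    (h : 2 * Real.cos ω = -1 - Real.cos (Real.pi / (2 * m))) : Irrational (ω / Real.pi) :=
  irrational_div_pi_of_cos_eq hm (-1) (-1) (by push_cast; linarith)

/-- The companion composite (`R₀₁(π/(2m))` followed by a quarter turn about a perpendicular coordinate axis): `2 cos ω = cos (π/(2m)) − 1 ⇒ ω/π ∉ ℚ`
for `m ≥ 2`. [cite: Niven1956, Ch. III §3] -/
theorem irrational_div_pi_of_two_cos_eq_sub {m : ℕ} (hm : 2 ≤ m) {ω : ℝ}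
    (h : 2 * Real.cos ω = Real.cos (Real.pi / (2 * m)) - 1) : Irrational (ω / Real.pi) :=
  irrational_div_pi_of_cos_eq hm 1 1 (by push_cast; linarith)

end Summit.QuantumFields.YangMills.Theorems.ROT.KingStabiliser

end
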